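import Summits.BirchSwinnertonDyer.BirchSwinnertonDyer.Theorems.AlignedTransportAtTwoMainConjectureOfRankZeroBSDAtTwoSelmerLayerModel
import Literature.NumberTheory.EllipticCurves.IwasawaSelmerControlExactCountProofs
import Literature.NumberTheory.EllipticCurves.IwasawaDualLayerCoinvariantsProofs
import Literature.NumberTheory.EllipticCurves.SelmerInftyTorsionFiniteProofs
import Literature.NumberTheory.EllipticCurves.SelmerCorankControlRatProofs
import Literature.NumberTheory.EllipticCurves.IwasawaSelmerTorsionProofs
import HarnessLib

/-!
# Route `AlignedTransportAtTwo`, crux C2 `MainConjectureOfRankZeroBSDAtTwo` (stmt-BirchSwinnertonDyer-22298):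
# PONTRYAGIN DUALITY AT EVERY LAYER ON THE CONTROL THEOREM'S OWN GROUP —
# `Sel_∞^{Γ_n} = Sel_∞ ⊓ layerInvariants n ≃ ker((conj_γ)^{pⁿ} − 1)`, `X/ω_n X ≃ Hom(Sel_∞^{Γ_n}, ℚ/ℤ)`, and
# `corank_{ℤ_p} Sel_∞^{Γ_n} = rank_{ℤ_p} X/ω_n X` (unconditional, every number field, every `ℤ_p`-extension, every `n`)

HONEST FRAMING (cell `bsd-f1-sign2`, WIDTH-5 attached prover seat `bsd-line-att-p5` gen 40 on line `birth` of the lead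
`bsd-line-att-p2`; `--supports` stmt-BirchSwinnertonDyer-22298, closes nothing; BSD is NOT proved by any of this; the crux
C2, its verdict «blocked-on `Rank1Residual.GreenbergMuConjectureIrreducible`» and every registered stub are untouched).
THEOREMS ONLY — no `def`, no instance, no named fact, no `sorry`. First half of the lineage's LAYER-`n` CORANK CONTROL
(second half: `…SelmerLayerControl`). The tree proves Mazur's control theorem in corank form AT THE BASE LAYER ONLY
(`finite_and_coinvariantsRank_eq_selmerCorank_of_finite_coker`, step (2) = Pontryagin duality `X/TX ≅ Hom(Sel_∞^{Γ_K}, ℚ/ℤ)`);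
here is step (2) at every layer `n` (`ω_n = (1+T)^{pⁿ} − 1`), for EVERY number field `K`, EVERY `ℤ_p`-extension `κ` with
topological generator `γ`, EVERY Pontryagin-dual datum `D` (finite generation of `X = D.X` over `Λ` only for the counts):

* §1 `conjH1_eq_self_of_conjH1_pow_eq_self` — a class of `H¹(K_∞, E[p^∞])` fixed by `γ^{pⁿ}` is fixed by all of
  `Γ_n = κ⁻¹(pⁿℤ_p)` (layer-`n` twin of the tree's `conjH1_eq_self_of_isTopGenerator`); `mem_layerInvariants_iff_conjH1_pow_eq_self`;
  ★ `exists_addEquiv_selmerInvariants_endInvariants` — `Sel_∞^{Γ_n} ≃+ ker((conj_γ|_{Sel_∞})^{pⁿ} − 1)`.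
* §2 `finite_torsionBy_of_addEquiv_characterModule` (a group whose character group is a finitely generated `ℤ_p`-module has
  finite `p`-torsion); `module_finite_int_quotient` (`X/IX` is `ℤ_p`-finite when `Λ/I` is);
  ★★ `zpCorank_endInvariants_eq_lambdaInvariant_quotient` — `corank ker g = rank_{ℤ_p} X/fX` for ANY pair `(f, g)` with `f`
  acting as `g` and `Λ/(f)` `ℤ_p`-finite; `isDistinguishedAt_omega`, `module_finite_int_quotient_omega`;
  ★★ `exists_addEquiv_layerQuotient_characterModule_selmerInvariants` — **`X/ω_n X ≃+ Hom(Sel_∞^{Γ_n}, ℚ/ℤ)`** with formula;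
  ★★ `zpCorank_selmerInvariants_eq_lambdaInvariant_layerQuotient` — **`corank_{ℤ_p} Sel_∞^{Γ_n} = rank_{ℤ_p} X/ω_n X`**.

References: R. Greenberg, LNM 1716 (1999), §1 pp. 60–62, 65, §3 p. 85 [GreenbergLNM1716]; B. Mazur, Invent. Math. 18 (1972),
§6 [Mazur1972]; L. Washington, GTM 83, §§7.1, 13.1, 13.2 (Prop. 13.8), 13.4 [Washington1997].
-/

set_option linter.dupNamespace false
set_option autoImplicit false

noncomputable section

open scoped Classical AddSubgroup TensorProduct

universe u

namespace Summit.BirchSwinnertonDyer.BirchSwinnertonDyer.Theorems.AlignedTransportAtTwoSelmerLayerDuality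

open WeierstrassCurve Literature.NumberTheory.EllipticCurves Literature.NumberTheory.EllipticCurves.IwasawaDual
  Summit.BirchSwinnertonDyer.BirchSwinnertonDyer.Theorems.AlignedTransportAtTwoSelmerLayerModel

/-! ## §1 `Sel_∞^{Γ_n}` is the kernel of `(conj_γ)^{pⁿ} − 1` -/

section Invariants

variable {K : Type u} [Field K] [NumberField K] (W : WeierstrassCurve K) {p : ℕ} [Fact p.Prime]
  (κ : ZpExtension K p) {γ : Field.absoluteGaloisGroup K}

/-- **A class fixed by `γ^{pⁿ}` is fixed by `Γ_n = Gal(K̄/K_n) = κ⁻¹(pⁿℤ_p)`** (layer-`n` twin of the tree's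
`conjH1_eq_self_of_isTopGenerator`, same proof): the class is fixed by an open normal subgroup `Nrm` of `Γ_K`
(`exists_openNormalSubgroup_conjH1_eq`) and by `ker κ` (`conjH1_of_mem`); if `[Γ_K : Nrm] = p^a e`, `p ∤ e`, then
`κ(Nrm) ⊇ p^a ℤ_p`, and for `σ` with `κ σ = pⁿ x`, `x ≡ k (mod p^a)`, one has `σ ∈ ker κ · Nrm · (γ^{pⁿ})^k`.
[cite: GreenbergLNM1716, §3 p. 85 (`Sel_E(F_∞)_p^{Γ_n}`, `Γ_n = ⟨γ^{pⁿ}⟩ topologically)] [cite: Washington1997, §13.1] -/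
theorem conjH1_eq_self_of_conjH1_pow_eq_self (hγ : κ.IsTopGenerator γ) (n : ℕ)
    {c : W.subgroupH1 p κ.kerSubgroup} (hc : W.conjH1 p κ.kerSubgroup (γ ^ p ^ n) c = c)
    {σ : Field.absoluteGaloisGroup K} (hσ : σ ∈ κ.layerSubgroup n) :
    W.conjH1 p κ.kerSubgroup σ c = c := by
  obtain ⟨Nrm, hNrm⟩ := W.exists_openNormalSubgroup_conjH1_eq κ c
  haveI : Finite (Field.absoluteGaloisGroup K ⧸ Nrm.toSubgroup) :=
    Subgroup.quotient_finite_of_isOpen _ Nrm.isOpen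
  have hd : Nrm.toSubgroup.index ≠ 0 := Subgroup.index_ne_zero_of_finite
  obtain ⟨a, e, he, hde⟩ := Nat.exists_eq_pow_mul_and_not_dvd hd p (Fact.out : p.Prime).ne_one
  obtain ⟨u, hu⟩ := IwasawaDual.isUnit_natCast_padicInt (p := p) he
  -- powers of `γ^{pⁿ}` fix `c`
  have hγk : ∀ k : ℕ, W.conjH1 p κ.kerSubgroup ((γ ^ p ^ n) ^ k) c = c := fun k ↦ by
    induction k with
    | zero => rw [pow_zero, W.conjH1_one_holds p κ.kerSubgroup, AddMonoidHom.id_apply]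
    | succ k ih =>
      rw [pow_succ, W.conjH1_mul_holds p κ.kerSubgroup, AddMonoidHom.comp_apply, hc, ih]
  -- `κ σ = pⁿ x`, `x = k + p^a z`
  obtain ⟨x, hx⟩ := ZpExtension.mem_layerSubgroup.mp hσ
  obtain ⟨z, hz⟩ := Ideal.mem_span_singleton.mp (PadicInt.appr_spec a x)
  -- `ν = g^{[Γ_K : Nrm]} ∈ Nrm` with `κ ν = pⁿ p^a z`
  obtain ⟨g, hg⟩ := κ.surjective (Multiplicative.ofAdd ((p : ℤ_[p]) ^ n * z * ((u⁻¹ : ℤ_[p]ˣ) : ℤ_[p])))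
  have hg' : κ g = Multiplicative.ofAdd ((p : ℤ_[p]) ^ n * z * ((u⁻¹ : ℤ_[p]ˣ) : ℤ_[p])) := hg
  have hνN : g ^ Nrm.toSubgroup.index ∈ Nrm := Nrm.toSubgroup.pow_index_mem g
  have hκν : (κ (g ^ Nrm.toSubgroup.index)).toAdd = (p : ℤ_[p]) ^ n * ((p : ℤ_[p]) ^ a * z) := by
    rw [map_pow, hg', ← ofAdd_nsmul, toAdd_ofAdd, nsmul_eq_mul, hde, Nat.cast_mul, Nat.cast_pow, ← hu]
    have : ((u : ℤ_[p]) * ((u⁻¹ : ℤ_[p]ˣ) : ℤ_[p])) = 1 := Units.mul_inv u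
    linear_combination ((p : ℤ_[p]) ^ a * (p : ℤ_[p]) ^ n * z) * this
  have hκγk : (κ ((γ ^ p ^ n) ^ PadicInt.appr x a)).toAdd = (p : ℤ_[p]) ^ n * (PadicInt.appr x a : ℤ_[p]) := by
    rw [← pow_mul, map_pow, show κ γ = Multiplicative.ofAdd 1 from hγ, ← ofAdd_nsmul, toAdd_ofAdd, nsmul_eq_mul,
      mul_one, Nat.cast_mul, Nat.cast_pow]
  -- `h = σ ((γ^{pⁿ})^k)⁻¹ ν⁻¹ ∈ ker κ`
  have hh : σ * ((γ ^ p ^ n) ^ PadicInt.appr x a)⁻¹ * (g ^ Nrm.toSubgroup.index)⁻¹ ∈ κ.kerSubgroup := by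
    rw [ZpExtension.mem_kerSubgroup, map_mul, map_mul, map_inv, map_inv]
    apply Multiplicative.toAdd.injective
    rw [toAdd_mul, toAdd_mul, toAdd_inv, toAdd_inv, hκν, hκγk, toAdd_one, hx]
    linear_combination ((p : ℤ_[p]) ^ n) * hz
  have hdecomp : σ = σ * ((γ ^ p ^ n) ^ PadicInt.appr x a)⁻¹ * (g ^ Nrm.toSubgroup.index)⁻¹ *
      g ^ Nrm.toSubgroup.index * (γ ^ p ^ n) ^ PadicInt.appr x a := by group
  conv_lhs => rw [hdecomp]
  rw [W.conjH1_mul_holds p κ.kerSubgroup _ ((γ ^ p ^ n) ^ _), AddMonoidHom.comp_apply, hγk,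
    W.conjH1_mul_holds p κ.kerSubgroup _ (g ^ _), AddMonoidHom.comp_apply, hNrm _ hνN,
    W.conjH1_of_mem_holds p κ.kerSubgroup hh, AddMonoidHom.id_apply]

/-- **`H¹(K_∞, E[p^∞])^{Γ_n} = H¹(K_∞, E[p^∞])^{γ^{pⁿ}}`**: membership in `layerInvariants κ n` is being fixed by
`conj_{γ^{pⁿ}}` (`γ^{pⁿ} ∈ Γ_n`, `ZpExtension.pow_mem_layerSubgroup`, and §1's lemma).
[cite: GreenbergLNM1716, §3 p. 85] -/
theorem mem_layerInvariants_iff_conjH1_pow_eq_self (hγ : κ.IsTopGenerator γ) (n : ℕ)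
    (c : W.subgroupH1 p κ.kerSubgroup) :
    c ∈ W.layerInvariants κ n ↔ W.conjH1 p κ.kerSubgroup (γ ^ p ^ n) c = c := by
  rw [mem_layerInvariants_iff]
  exact ⟨fun h ↦ h _ (κ.pow_mem_layerSubgroup hγ n),
    fun h σ hσ ↦ conjH1_eq_self_of_conjH1_pow_eq_self W κ hγ n h hσ⟩

/-- ★ **`Sel_∞^{Γ_n} ≃+ ker ((conj_γ|_{Sel_∞})^{pⁿ} − 1)`**: the `Γ_n`-invariants `Sel_∞ ⊓ layerInvariants n` of the control
theorem and the kernel of `φ^{pⁿ} − 1`, `φ = conjSelmerInfty κ γ` (the object of the tree's layer-`n` Pontryagin duality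
`IsDualPair.exists_layerCoinvariants_addEquiv`), are the same subgroup of `H¹(K_∞, E[p^∞])`; the isomorphism is the identity
on underlying classes. [cite: GreenbergLNM1716, §3 p. 85] -/
theorem exists_addEquiv_selmerInvariants_endInvariants (hγ : κ.IsTopGenerator γ) (n : ℕ) :
    ∃ e : ↥(W.selmerInfty κ ⊓ W.layerInvariants κ n) ≃+ ↥(endInvariants ((W.conjSelmerInfty κ γ) ^ (p ^ n) - 1)),
      ∀ a, (((e a : ↥(endInvariants ((W.conjSelmerInfty κ γ) ^ (p ^ n) - 1))) : W.selmerInfty κ) :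
        W.subgroupH1 p κ.kerSubgroup) = a := by
  -- the two membership predicates agree
  have key : ∀ s : W.selmerInfty κ, (s : W.subgroupH1 p κ.kerSubgroup) ∈ W.layerInvariants κ n ↔
      s ∈ endInvariants ((W.conjSelmerInfty κ γ) ^ (p ^ n) - 1) := fun s ↦ by
    rw [mem_layerInvariants_iff_conjH1_pow_eq_self W κ hγ n, mem_endInvariants_iff, End_sub_apply,
      AddMonoid.End.one_apply, sub_eq_zero, ← coe_conjSelmerInfty_pow_apply]
    exact ⟨fun h ↦ Subtype.ext h, fun h ↦ congrArg Subtype.val h⟩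
  let f : ↥(W.selmerInfty κ ⊓ W.layerInvariants κ n) → ↥(endInvariants ((W.conjSelmerInfty κ γ) ^ (p ^ n) - 1)) :=
    fun a ↦ ⟨⟨(a : W.subgroupH1 p κ.kerSubgroup), (AddSubgroup.mem_inf.mp a.2).1⟩,
      (key _).mp (AddSubgroup.mem_inf.mp a.2).2⟩
  let g : ↥(endInvariants ((W.conjSelmerInfty κ γ) ^ (p ^ n) - 1)) → ↥(W.selmerInfty κ ⊓ W.layerInvariants κ n) :=
    fun b ↦ ⟨((b : W.selmerInfty κ) : W.subgroupH1 p κ.kerSubgroup),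
      AddSubgroup.mem_inf.mpr ⟨(b : W.selmerInfty κ).2, (key _).mpr b.2⟩⟩
  let e : ↥(W.selmerInfty κ ⊓ W.layerInvariants κ n) ≃+ ↥(endInvariants ((W.conjSelmerInfty κ γ) ^ (p ^ n) - 1)) :=
    { toFun := f
      invFun := g
      left_inv := fun a ↦ Subtype.ext rfl
      right_inv := fun b ↦ Subtype.ext (Subtype.ext rfl)
      map_add' := fun a b ↦ Subtype.ext (Subtype.ext rfl) }
  exact ⟨e, fun a ↦ rfl⟩

end Invariants

/-! ## §2 Pontryagin duality at layer `n` for `Sel_∞^{Γ_n}`, and the count `corank Sel_∞^{Γ_n} = rank_{ℤ_p} X/ω_n X` -/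

section Pontryagin

variable (p : ℕ) [Fact p.Prime]

/-- **A group whose character group is (as a group) a finitely generated `ℤ_p`-module has finite `p`-torsion**:
`Hom(S[p], ℚ/ℤ)` is a quotient of `Hom(S, ℚ/ℤ)/p ≅ N/pN` (characters of a subgroup extend, `ℚ/ℤ` injective; the
restriction kills `p·Hom(S, ℚ/ℤ)`), which is finite (`ZpCorank.natCard_modN_le`), and a group with finite character group
is finite (`finite_of_finite_characterModule`). [cite: GreenbergLNM1716, §1 p. 60 ("cofinitely generated")] -/
theorem finite_torsionBy_of_addEquiv_characterModule {S : Type u} [AddCommGroup S] {N : Type*} [AddCommGroup N]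
    [Module ℤ_[p] N] [Module.Finite ℤ_[p] N] (Ψ : N ≃+ CharacterModule S) : Finite (S[(p : ℤ)]) := by
  haveI : Finite (ModN N p) := (ZpCorank.natCard_modN_le p N).1
  haveI : Finite (ModN (CharacterModule S) p) := Finite.of_equiv _ (modNEquiv Ψ p).toEquiv
  let r : ModN (CharacterModule S) p →+ CharacterModule (S[(p : ℤ)]) :=
    ModN.liftEquiv.symm
      ⟨(CharacterModule.dual ((S[(p : ℤ)]).subtype.toIntLinearMap)).toAddMonoidHom, fun χ ↦ by
        refine AddMonoidHom.ext fun b ↦ ?_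
        show p • χ (b : S) = 0
        rw [← map_nsmul, ← AddSubgroupClass.coe_nsmul, AddSubgroup.torsionBy.nsmul b,
          ZeroMemClass.coe_zero, map_zero]⟩
  have hr : ∀ (χ : CharacterModule S) (b : S[(p : ℤ)]), r (ModN.mkQ p χ) b = χ b := fun _ _ ↦ rfl
  haveI : Finite (CharacterModule (S[(p : ℤ)])) := by
    refine Finite.of_surjective r fun ψ ↦ ?_
    obtain ⟨χ, hχ⟩ := CharacterModule.dual_surjective_of_injective
      ((S[(p : ℤ)]).subtype.toIntLinearMap) (fun a b h ↦ Subtype.ext h) ψ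
    refine ⟨ModN.mkQ p χ, CharacterModule.ext (A := S[(p : ℤ)]) fun b ↦ ?_⟩
    rw [hr, ← hχ]
    rfl
  exact PontryaginCard.finite_of_finite_characterModule _

/-- **`X/fX` is a finitely generated `ℤ_p`-module when `X` is finitely generated over `Λ` and `Λ/(f)` is finitely
generated over `ℤ_p`** (`X/fX` is finitely generated over `Λ/(f)`, and `ℤ_p → Λ/(f) ↷ X/fX` is a scalar tower; the
`ℤ_p`-structure is the restricted one of `lambdaInvariant`). [cite: Washington1997, §13.2 (Prop. 13.8)] -/
theorem module_finite_int_quotient {X : Type*} [AddCommGroup X] [Module (IwasawaAlgebra p) X]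
    [Module.Finite (IwasawaAlgebra p) X] (I : Ideal (IwasawaAlgebra p))
    (hI : Module.Finite ℤ_[p] (IwasawaAlgebra p ⧸ I)) :
    Module.Finite ℤ_[p] (RestrictScalars ℤ_[p] (IwasawaAlgebra p) (X ⧸ (I • ⊤ : Submodule (IwasawaAlgebra p) X))) := by
  letI : Module ℤ_[p] (X ⧸ (I • ⊤ : Submodule (IwasawaAlgebra p) X)) :=
    Module.compHom _ (algebraMap ℤ_[p] (IwasawaAlgebra p))
  haveI : IsScalarTower ℤ_[p] (IwasawaAlgebra p ⧸ I) (X ⧸ (I • ⊤ : Submodule (IwasawaAlgebra p) X)) := by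
    refine ⟨fun c q m ↦ ?_⟩
    obtain ⟨r, rfl⟩ := Ideal.Quotient.mk_surjective q
    induction m using Submodule.Quotient.induction_on with
    | H x =>
      change (Submodule.Quotient.mk ((c • r) • x) : X ⧸ (I • ⊤ : Submodule (IwasawaAlgebra p) X)) =
        Submodule.Quotient.mk ((algebraMap ℤ_[p] (IwasawaAlgebra p) c) • (r • x))
      rw [show (c • r : IwasawaAlgebra p) = algebraMap ℤ_[p] (IwasawaAlgebra p) c * r from Algebra.smul_def c r,
        mul_smul]
  have h : Module.Finite ℤ_[p] (X ⧸ (I • ⊤ : Submodule (IwasawaAlgebra p) X)) :=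
    Module.Finite.trans (IwasawaAlgebra p ⧸ I) _
  exact h

variable {K : Type u} [Field K] [NumberField K] (W : WeierstrassCurve K) (κ : ZpExtension K p)
  {γ : Field.absoluteGaloisGroup K}

/-- ★★ **`corank_{ℤ_p} ker g = rank_{ℤ_p} X/fX` for every pair `(f, g)` with `f ∈ Λ` acting on `X` as the endomorphism `g` of
`Sel_∞`** (`toDual (f • x) = toDual x ∘ g`), when `X = D.X` is finitely generated over `Λ` and `Λ/(f)` over `ℤ_p`:
Pontryagin duality `X/fX ≃+ Hom(ker g, ℚ/ℤ)` (`IsDualPair.exists_quotient_addEquiv_of_smul`), `X/fX` is `ℤ_p`-finite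
(`module_finite_int_quotient`), `ker g ⊆ Sel_∞` is `p`-primary with finite `p`-torsion
(`finite_torsionBy_of_addEquiv_characterModule`), so `rank_{ℤ_p} X/fX = corank ker g`
(`ZpCorank.finrank_eq_zpCorank_of_addEquiv_characterModule`) and `rank_{ℤ_p} = dim_{ℚ_p} ℚ_p ⊗` (`IsBaseChange.finrank_eq`).
[cite: GreenbergLNM1716, §1 pp. 60, 65] -/
theorem zpCorank_endInvariants_eq_lambdaInvariant_quotient (hγ : κ.IsTopGenerator γ) (D : W.SelmerDualData κ γ)
    [Module.Finite (IwasawaAlgebra p) D.X] {f : IwasawaAlgebra p} {g : AddMonoid.End (W.selmerInfty κ)}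
    (hfg : ∀ (x : D.X) (s : W.selmerInfty κ), D.toDual (f • x) s = D.toDual x (g s))
    (hf : Module.Finite ℤ_[p] (IwasawaAlgebra p ⧸ Ideal.span {f})) :
    zpCorank ↥(endInvariants g) p =
      lambdaInvariant p (D.X ⧸ (Ideal.span {f} • ⊤ : Submodule (IwasawaAlgebra p) D.X)) := by
  obtain ⟨Ψ, -⟩ := (D.isDualPair W hγ).exists_quotient_addEquiv_of_smul hfg
  letI : Module ℤ_[p] (D.X ⧸ (Ideal.span {f} • ⊤ : Submodule (IwasawaAlgebra p) D.X)) :=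
    Module.compHom _ (algebraMap ℤ_[p] (IwasawaAlgebra p))
  haveI : Module.Finite ℤ_[p] (D.X ⧸ (Ideal.span {f} • ⊤ : Submodule (IwasawaAlgebra p) D.X)) :=
    module_finite_int_quotient p (Ideal.span {f}) hf
  haveI : Finite (↥(endInvariants g))[(p : ℤ)] := finite_torsionBy_of_addEquiv_characterModule p Ψ
  have hprim : ∀ s : ↥(endInvariants g), ∃ k : ℕ, p ^ k • s = 0 := fun s ↦ by
    obtain ⟨k, hk⟩ := W.exists_pow_smul_subgroupH1_ker_eq_zero κ ((s : W.selmerInfty κ) : W.subgroupH1 p κ.kerSubgroup)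
    exact ⟨k, Subtype.ext (Subtype.ext (by
      rw [AddSubgroupClass.coe_nsmul, AddSubgroupClass.coe_nsmul, hk]; rfl))⟩
  rw [← ZpCorank.finrank_eq_zpCorank_of_addEquiv_characterModule p hprim Ψ]
  exact ((TensorProduct.isBaseChange ℤ_[p] (D.X ⧸ (Ideal.span {f} • ⊤ : Submodule (IwasawaAlgebra p) D.X))
    ℚ_[p]).finrank_eq).symm

/-- **`ω_n = (1+T)^{pⁿ} − 1 ∈ ℤ_p[T]` is a distinguished polynomial** (monic of degree `pⁿ`; the lower coefficients
`binom(pⁿ, i)`, `0 < i < pⁿ`, are divisible by `p`, and the constant term is `0`). [cite: Washington1997, §7.1 and §13.2] -/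
theorem isDistinguishedAt_omega (n : ℕ) :
    ((Polynomial.X + Polynomial.C 1) ^ (p ^ n) - 1 : Polynomial ℤ_[p]).IsDistinguishedAt
      (IsLocalRing.maximalIdeal ℤ_[p]) := by
  have hp : p.Prime := Fact.out
  have hne : ((Polynomial.X + Polynomial.C 1) ^ (p ^ n) : Polynomial ℤ_[p]) ≠ 0 :=
    ((Polynomial.monic_X_add_C 1).pow _).ne_zero
  have hdeg0 : ((Polynomial.X + Polynomial.C 1) ^ (p ^ n) : Polynomial ℤ_[p]).natDegree = p ^ n := by
    rw [Polynomial.natDegree_pow, Polynomial.natDegree_X_add_C, mul_one]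
  have hmonic : ((Polynomial.X + Polynomial.C 1) ^ (p ^ n) - 1 : Polynomial ℤ_[p]).Monic := by
    refine ((Polynomial.monic_X_add_C 1).pow _).sub_of_left ?_
    rw [Polynomial.degree_one, Polynomial.degree_eq_natDegree hne, hdeg0]
    exact_mod_cast pow_pos hp.pos n
  have hdeg : ((Polynomial.X + Polynomial.C 1) ^ (p ^ n) - 1 : Polynomial ℤ_[p]).natDegree = p ^ n := by
    rw [Polynomial.natDegree_sub_eq_left_of_natDegree_lt, hdeg0]
    rw [hdeg0, Polynomial.natDegree_one]
    exact pow_pos hp.pos n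
  refine ⟨⟨fun {i} hi => ?_⟩, hmonic⟩
  rw [hdeg] at hi
  rw [Polynomial.coeff_sub, Polynomial.coeff_X_add_C_pow, one_pow, one_mul, Polynomial.coeff_one,
    PadicInt.maximalIdeal_eq_span_p, Ideal.mem_span_singleton]
  by_cases hi0 : i = 0
  · subst hi0
    simp
  · rw [if_neg hi0, sub_zero]
    exact Nat.cast_dvd_cast (hp.dvd_choose_pow hi0 hi.ne)

/-- `Λ/(ω_n)` is a finitely generated `ℤ_p`-module (free of rank `pⁿ`; Weierstrass division by the distinguished `ω_n`,
tree `IwasawaAlgebra.finite_quotient_pow`). [cite: Washington1997, Prop. 13.8] -/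
theorem module_finite_int_quotient_omega (n : ℕ) :
    Module.Finite ℤ_[p] (IwasawaAlgebra p ⧸
      Ideal.span {((1 + PowerSeries.X : PowerSeries ℤ_[p]) ^ (p ^ n) - 1 : IwasawaAlgebra p)}) := by
  have h := finite_quotient_pow p (isDistinguishedAt_omega p n) 1
  have he : Ideal.span {(((Polynomial.X + Polynomial.C 1) ^ (p ^ n) - 1 : Polynomial ℤ_[p]) : IwasawaAlgebra p) ^ 1} =
      Ideal.span {((1 + PowerSeries.X : PowerSeries ℤ_[p]) ^ (p ^ n) - 1 : IwasawaAlgebra p)} := by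
    rw [pow_one, Polynomial.coe_sub, Polynomial.coe_pow, Polynomial.coe_add, Polynomial.coe_X, Polynomial.coe_one,
      Polynomial.coe_C, map_one, add_comm]
  exact Module.Finite.equiv (Ideal.quotientEquivAlgOfEq ℤ_[p] he).toLinearEquiv

/-- ★★ **`X/ω_n X ≃+ Hom(Sel_∞^{Γ_n}, ℚ/ℤ)`** — Pontryagin duality at layer `n` on the control theorem's own group
`Sel_∞ ⊓ layerInvariants n` (the tree's `IsDualPair.exists_layerCoinvariants_addEquiv` composed with §1's identification),
with its formula. [cite: GreenbergLNM1716, §1 p. 62 and §3 p. 85] [cite: Washington1997, §13.4] -/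
theorem exists_addEquiv_layerQuotient_characterModule_selmerInvariants (hγ : κ.IsTopGenerator γ)
    (D : W.SelmerDualData κ γ) (n : ℕ) :
    ∃ Ψ : (D.X ⧸ (Ideal.span {((1 + PowerSeries.X : PowerSeries ℤ_[p]) ^ (p ^ n) - 1 : IwasawaAlgebra p)} • ⊤ :
        Submodule (IwasawaAlgebra p) D.X)) ≃+ CharacterModule ↥(W.selmerInfty κ ⊓ W.layerInvariants κ n),
      ∀ (x : D.X) (a : ↥(W.selmerInfty κ ⊓ W.layerInvariants κ n)),
        Ψ (Submodule.Quotient.mk x) a =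
          D.toDual x ⟨(a : W.subgroupH1 p κ.kerSubgroup), (AddSubgroup.mem_inf.mp a.2).1⟩ := by
  obtain ⟨Ψ, hΨ⟩ := (D.isDualPair W hγ).exists_layerCoinvariants_addEquiv n
  obtain ⟨e, he⟩ := exists_addEquiv_selmerInvariants_endInvariants W κ hγ n
  refine ⟨Ψ.trans e.symm.addMonoidHomCongrLeft, fun x a ↦ ?_⟩
  change Ψ (Submodule.Quotient.mk x) (e a) = _
  rw [hΨ]
  congr 1
  exact Subtype.ext (he a)

/-- ★★ **`corank_{ℤ_p} Sel_∞^{Γ_n} = rank_{ℤ_p} X/ω_n X`** for every number field `K`, every `ℤ_p`-extension `κ` with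
topological generator `γ`, every Pontryagin-dual datum with `X` finitely generated over `Λ`, every `n`
(`zpCorank_endInvariants_eq_lambdaInvariant_quotient` at `(ω_n, φ^{pⁿ} − 1)`, `IsDualPair.toDual_omega_smul`, transported
along §1). The case `n = 0` is the tree's step (2) of `finite_and_coinvariantsRank_eq_selmerCorank_of_finite_coker`.
[cite: GreenbergLNM1716, §1 pp. 60–62, 65] -/
theorem zpCorank_selmerInvariants_eq_lambdaInvariant_layerQuotient (hγ : κ.IsTopGenerator γ) (D : W.SelmerDualData κ γ)
    [Module.Finite (IwasawaAlgebra p) D.X] (n : ℕ) :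
    zpCorank ↥(W.selmerInfty κ ⊓ W.layerInvariants κ n) p =
      lambdaInvariant p (D.X ⧸ (Ideal.span {((1 + PowerSeries.X : PowerSeries ℤ_[p]) ^ (p ^ n) - 1 : IwasawaAlgebra p)} •
        ⊤ : Submodule (IwasawaAlgebra p) D.X)) := by
  obtain ⟨e, -⟩ := exists_addEquiv_selmerInvariants_endInvariants W κ hγ n
  rw [zpCorank_congr e p]
  exact zpCorank_endInvariants_eq_lambdaInvariant_quotient p W κ hγ D ((D.isDualPair W hγ).toDual_omega_smul n)
    (module_finite_int_quotient_omega p n)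

end Pontryagin

end Summit.BirchSwinnertonDyer.BirchSwinnertonDyer.Theorems.AlignedTransportAtTwoSelmerLayerDuality

end
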